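import Literature.Probability.Moments.AzumaHoeffdingMartingalePart
import HarnessLib

/-!
# Azuma–Hoeffding for Doob martingale parts (stub S5 of line `dynkin-azuma-collision-innovations`)

Helper file (`--supports stmt-AtomisticToContinuum-10967`) proving the registered stub
`stub_azumaHoeffding` (S5) of the lead's checked skeleton for the crux
`Summit.AtomisticToContinuum.HydrodynamicLimit.Theses.AntiMazurCoboundaries.KineticFluxLdDecay`
(stmt-AtomisticToContinuum-10967; byte-identical twin in route `FluxGibbsianityLdDrude`), line
`dynkin-azuma-collision-innovations`. The statement is spelled exactly as registered.

Content: for a real process `f` adapted to an ARBITRARY filtration `ℱ` of an arbitrary measurable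
space, started at `0`, with increments a.e. bounded by `R`, the martingale part
`M = martingalePart f ℱ μ` of its Doob decomposition has `∫⁻ ofReal (exp (t Mₙ)) dμ ≤
ofReal (exp (2 n R² t²))` for every `n` and real `t`. In the line this is the ONLY input controlling
the innovations `M` of the clipped collision-payload partial sums `X̃` at the deterministic horizon
`m = (N+1)(K+1)` (`R = 8cℓ(b+δ₀)`, `t = -5/h`), giving per-particle pressure `∝ (K+1)/τ² → 0`
uniformly in `N`.

The mathematics is the generic, kernel-free Azuma–Hoeffding bound
`Literature.Probability.Moments.lintegral_exp_mul_martingalePart_le`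
(`Literature/Probability/Moments/AzumaHoeffdingMartingalePart.lean`: chord bound
`e^{sx} ≤ cosh (sa) + x sinh (sa) / a` on `[-a, a]`, pull-out property of the conditional expectation,
`cosh y ≤ e^{y²/2}`, induction on `n`; martingale differences of `martingalePart f` are bounded by `2R`);
this file is the thin wrapper with the registered binder list. The hypothesis `hR : 0 ≤ R` of the
registered signature is not needed (for `R < 0` the hypothesis `hbdd` is a.e. false on a probability
space), hence the `unusedVariables` waiver on that one declaration.
-/

noncomputable section

open MeasureTheory ProbabilityTheory

namespace Summit.AtomisticToContinuum.HydrodynamicLimit.Theorems.DynkinAzuma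

-- `hR` belongs to the registered stub signature (verbatim match required) but the proof does not need it.
set_option linter.unusedVariables false in
/-- **S5 · Azuma–Hoeffding for Doob martingale parts.** For a real process `f` adapted to a filtration
`ℱ` on a probability space, with `f 0 = 0` and increments a.e. bounded by `R`, the martingale part of
its Doob decomposition satisfies `∫⁻ ofReal (exp (t · martingalePart f ℱ μ n)) dμ ≤ ofReal (exp (2 n R² t²))`
for all `n : ℕ` and `t : ℝ` — `Literature.Probability.Moments.lintegral_exp_mul_martingalePart_le`
(Azuma 1967 / Hoeffding 1963, elementary proof valid for an arbitrary filtration). -/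
theorem stub_azumaHoeffding {Ω : Type*} {m0 : MeasurableSpace Ω} (μ : Measure Ω)
    [IsProbabilityMeasure μ] (ℱ : Filtration ℕ m0) (f : ℕ → Ω → ℝ) (R : ℝ) (hR : 0 ≤ R)
    (hf : StronglyAdapted ℱ f) (h0 : ∀ ω, f 0 ω = 0)
    (hbdd : ∀ᵐ ω ∂μ, ∀ i, |f (i + 1) ω - f i ω| ≤ R) (n : ℕ) (t : ℝ) :
    ∫⁻ ω, ENNReal.ofReal (Real.exp (t * martingalePart f ℱ μ n ω)) ∂μ ≤
      ENNReal.ofReal (Real.exp (2 * n * R ^ 2 * t ^ 2)) :=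
  Literature.Probability.Moments.lintegral_exp_mul_martingalePart_le μ ℱ f R hf h0 hbdd n t

end Summit.AtomisticToContinuum.HydrodynamicLimit.Theorems.DynkinAzuma
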